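import Mathlib
import Summits.QuantumFields.YangMills.Theorems.LuscherReductionTwistedTraceScalingInnerKernelComparison
import HarnessLib

/-!
# Kernel parity: an ODD first-order kernel perturbation is invisible on EVEN states — the odd/even split of the DIAGONAL block
# (route `FlatTubeReduction`, crux K1 `NearFlatRatioLaw` stmt-QuantumFields-24720, registered stub `stub_boRate` = FCL 23943's `BORateAll`;
# rung R2b1 = RECORD-label femto gap; no summit statement is proved here)

Seat `ym-line-ftr-p1` g6 (prover).  Route RED lane A compares the lattice kernel `K₂` (in chart coordinates) with a model kernel `K₁` through a
POINTWISE RELATIVE bound `|K₂ − K₁| ≤ η K₁` (`…InnerKernelComparison.abs_form_sub_le_of_kernel_near`: `|⟨f,K₂f⟩ − ⟨f,K₁f⟩| ≤ ηM₁‖f‖²`).  For the RATE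
twin of `stub_boRate` this is too weak on the DIAGONAL block: the first-order deviation of the true kernel from the c-frozen fibred model is of size
`η ≍ β^{-1/2}·polylog ≫ λ_b(L³β)² ≍ β^{-2/3}` — but it is ODD under the fibre reflection `w ↦ −w` (cubic slow–fast term, frame transport), while the
adiabatic states `f⊗Ω_c` and the model are EVEN (ftr-p1 g5 memo `rate-twin-readiness-g5.md`, finding (A); FCL `Cruxes/FixedLatticeLaw/Lines/rate.md` RATE POINT 3).
This file proves the abstract odd/even split on a general s-finite measure space `(X, μ)` with a measure-preserving measurable involution (any measurable
equivalence) `ι`: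
* ★ `integral_prod_eq_zero_of_odd` — an integrand on `X × X` that is odd under `ι × ι` has integral `0` (no integrability needed);
* ★ `form_mul_odd_eq_zero` — `∫∫ Φ(x)·K(x,y)A(x,y)·Ψ(y) = 0` for `K` even, `A` odd, `Φ, Ψ` even;
* ★★ `abs_form_sub_le_of_kernel_near_odd` — DIAGONAL comparison with an odd first-order term: if `|K₂ − K₁(1 + A)| ≤ η₂K₁` pointwise with `K₁ ≥ 0`
  symmetric, `ι`-even, rows `≤ M₁`, `A` `ι`-odd, then for every `ι`-even `f`: `|⟨f,K₂f⟩ − ⟨f,K₁f⟩| ≤ η₂·M₁·‖f‖²` — only the SECOND-order size `η₂` is paid;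
* ★ `form_le_of_kernel_near_odd` — the one-sided (upper) consequence used by the door's (P5).
HONEST FRAMING: elementary measure theory (change of variables under a measure-preserving equivalence + Schur) for the registered stub of a crux of the
CONDITIONAL reduction route to the femto rung R2b1 (RECORD label); the chart supplying `K₁, K₂, A, ι` is OPEN (route RED lane A C4-CORE + the rate twin,
`Cruxes/NearFlatRatioLaw/Lines/borate.md`); nothing here is infinite volume, a continuum limit or the Clay mass gap.  No definitions, no named facts, no `sorry`.

## References
* B. Helffer, *Spectral Theory and its Applications*, CUP 2013, Lemma 7.1 (Schur's test) — [cite: Helffer2013, Lemma 7.1 pp.77–78].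
* M. Lüscher, Nucl. Phys. B219 (1983) 233, §3 (parity of the cubic vertex in the constant-mode expansion) — [cite: Luscher1983, §3].
-/

set_option autoImplicit false

noncomputable section

open MeasureTheory

namespace Summit.QuantumFields.YangMills.Theorems.FemtoTransferGap.KernelParity

open Summit.QuantumFields.YangMills.Theorems.FemtoTransferGap.KernelComparison

variable {X : Type*} [MeasurableSpace X] {μ : Measure X} [SFinite μ]

/-- ★ **An `ι × ι`-odd integrand on `X × X` integrates to zero** (for a measure-preserving measurable equivalence `ι`; no integrability hypothesis —
a non-integrable integrand has integral `0` by convention on both sides of the change of variables). [folklore] -/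
theorem integral_prod_eq_zero_of_odd (ι : X ≃ᵐ X) (hι : MeasurePreserving ι μ μ) {F : X × X → ℝ}
    (hodd : ∀ x y, F (ι x, ι y) = -F (x, y)) : ∫ p, F p ∂(μ.prod μ) = 0 := by
  have hmp : MeasurePreserving (ι.prodCongr ι) (μ.prod μ) (μ.prod μ) := hι.prod hι
  have h1 : ∫ p, F ((ι.prodCongr ι) p) ∂(μ.prod μ) = ∫ p, F p ∂(μ.prod μ) := hmp.integral_comp' F
  have h2 : ∫ p, F ((ι.prodCongr ι) p) ∂(μ.prod μ) = -∫ p, F p ∂(μ.prod μ) := by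
    rw [← integral_neg]
    refine integral_congr_ae (ae_of_all _ fun p => ?_)
    obtain ⟨x, y⟩ := p
    exact hodd x y
  linarith

/-- ★ **Even states do not see an odd kernel**: `∫∫ Φ(x)·(K(x,y)A(x,y))·Ψ(y) dμ dμ = 0` when `K` is `ι`-even, `A` is `ι`-odd and `Φ, Ψ` are `ι`-even
(product-integrable integrand). [folklore] [cite: Luscher1983, §3] -/
theorem form_mul_odd_eq_zero (ι : X ≃ᵐ X) (hι : MeasurePreserving ι μ μ) {K A : X → X → ℝ} {Φ Ψ : X → ℝ}
    (hK : ∀ x y, K (ι x) (ι y) = K x y) (hA : ∀ x y, A (ι x) (ι y) = -A x y) (hΦ : ∀ x, Φ (ι x) = Φ x) (hΨ : ∀ x, Ψ (ι x) = Ψ x)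
    (hI : Integrable (fun p : X × X => Φ p.1 * (K p.1 p.2 * A p.1 p.2) * Ψ p.2) (μ.prod μ)) :
    ∫ x, ∫ y, Φ x * (K x y * A x y) * Ψ y ∂μ ∂μ = 0 := by
  rw [integral_integral hI]
  refine integral_prod_eq_zero_of_odd ι hι fun x y => ?_
  dsimp only
  rw [hΦ, hΨ, hK, hA]
  ring

/-- ★★ **DIAGONAL comparison with an ODD first-order term**: if `|K₂ − K₁(1 + A)| ≤ η·K₁` pointwise, `K₁ ≥ 0` symmetric with rows `≤ M₁` and `ι`-even,
`A` `ι`-odd, then for every `ι`-EVEN `f` (with the usual product-integrability side conditions): `|⟨f,K₂f⟩ − ⟨f,K₁f⟩| ≤ η·M₁·‖f‖²`.  The first-order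
term `K₁A` — however large — contributes nothing; only the second-order size `η` of the remainder is paid.  (The rate twin of `stub_boRate` uses this with
`ι` = the fibre reflection `w ↦ −w`, `K₁` = the c-frozen fibred model, `A` = the cubic slow–fast / frame-transport term of relative size `β^{-1/2}·polylog`,
`η = O(β^{-1})`.) [cite: Helffer2013, Lemma 7.1 pp.77–78] [cite: Luscher1983, §3] -/
theorem abs_form_sub_le_of_kernel_near_odd (ι : X ≃ᵐ X) (hι : MeasurePreserving ι μ μ)
    {K₁ K₂ A : X → X → ℝ} {η M₁ : ℝ} (hη : 0 ≤ η) (hK₁ : ∀ x y, 0 ≤ K₁ x y)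
    (hsymm : ∀ x y, K₁ x y = K₁ y x) (hrow : ∀ᵐ x ∂μ, ∫ y, K₁ x y ∂μ ≤ M₁)
    (hK₁ι : ∀ x y, K₁ (ι x) (ι y) = K₁ x y) (hAι : ∀ x y, A (ι x) (ι y) = -A x y)
    (hnear : ∀ x y, |K₂ x y - K₁ x y * (1 + A x y)| ≤ η * K₁ x y)
    {f : X → ℝ} (hfι : ∀ x, f (ι x) = f x) (hf : Integrable (fun x => f x ^ 2) μ)
    (hI2 : Integrable (fun p : X × X => f p.1 * K₂ p.1 p.2 * f p.2) (μ.prod μ))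
    (hIA : Integrable (fun p : X × X => f p.1 * (K₁ p.1 p.2 * A p.1 p.2) * f p.2) (μ.prod μ))
    (hI : Integrable (fun p : X × X => |f p.1| * K₁ p.1 p.2 * |f p.2|) (μ.prod μ))
    (hIs : Integrable (fun p : X × X => f p.1 * K₁ p.1 p.2 * f p.2) (μ.prod μ))
    (hI₁ : Integrable (fun p : X × X => K₁ p.1 p.2 * f p.1 ^ 2) (μ.prod μ))
    (hI₂ : Integrable (fun p : X × X => K₁ p.1 p.2 * f p.2 ^ 2) (μ.prod μ)) :
    |(∫ x, ∫ y, f x * K₂ x y * f y ∂μ ∂μ) - ∫ x, ∫ y, f x * K₁ x y * f y ∂μ ∂μ| ≤ η * M₁ * ∫ x, f x ^ 2 ∂μ := by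
  -- the kernel with the odd part removed is (two-sided, relatively) close to `K₁`
  set K₂' : X → X → ℝ := fun x y => K₂ x y - K₁ x y * A x y with hK₂'
  have hnear' : ∀ x y, |K₂' x y - 1 * K₁ x y| ≤ η * 1 * K₁ x y := by
    intro x y
    have e : K₂' x y - 1 * K₁ x y = K₂ x y - K₁ x y * (1 + A x y) := by rw [hK₂']; ring
    rw [e, mul_one]
    exact hnear x y
  have hI2' : Integrable (fun p : X × X => f p.1 * K₂' p.1 p.2 * f p.2) (μ.prod μ) := by
    refine (hI2.sub hIA).congr (ae_of_all _ fun p => ?_)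
    simp only [hK₂', Pi.sub_apply]
    ring
  have h := abs_form_sub_le_of_kernel_near (μ := μ) zero_le_one hη hK₁ hsymm hrow hnear' hf hI2'.aestronglyMeasurable hI hIs hI₁ hI₂
  rw [one_mul, mul_one] at h
  -- the odd part integrates to zero against the even `f`
  have hodd : ∫ p, f p.1 * (K₁ p.1 p.2 * A p.1 p.2) * f p.2 ∂(μ.prod μ) = 0 :=
    integral_prod_eq_zero_of_odd ι hι (F := fun p : X × X => f p.1 * (K₁ p.1 p.2 * A p.1 p.2) * f p.2) fun x y => by
      dsimp only
      rw [hfι, hfι, hK₁ι, hAι]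
      ring
  have e : ∫ x, ∫ y, f x * K₂' x y * f y ∂μ ∂μ = ∫ x, ∫ y, f x * K₂ x y * f y ∂μ ∂μ := by
    rw [integral_integral hI2', integral_integral hI2]
    have : ∫ p, f p.1 * K₂' p.1 p.2 * f p.2 ∂(μ.prod μ) =
        ∫ p, (f p.1 * K₂ p.1 p.2 * f p.2 - f p.1 * (K₁ p.1 p.2 * A p.1 p.2) * f p.2) ∂(μ.prod μ) :=
      integral_congr_ae (ae_of_all _ fun p => by simp only [hK₂']; ring)
    rw [this, integral_sub hI2 hIA, hodd, sub_zero]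
  rw [e] at h
  exact h

/-- ★ One-sided consequence (UPPER, the direction the door's (P5) uses): `⟨f,K₂f⟩ ≤ ⟨f,K₁f⟩ + η·M₁·‖f‖²` for `ι`-even `f`, odd first-order term discarded.
[cite: Helffer2013, Lemma 7.1 pp.77–78] -/
theorem form_le_of_kernel_near_odd (ι : X ≃ᵐ X) (hι : MeasurePreserving ι μ μ)
    {K₁ K₂ A : X → X → ℝ} {η M₁ : ℝ} (hη : 0 ≤ η) (hK₁ : ∀ x y, 0 ≤ K₁ x y)
    (hsymm : ∀ x y, K₁ x y = K₁ y x) (hrow : ∀ᵐ x ∂μ, ∫ y, K₁ x y ∂μ ≤ M₁)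
    (hK₁ι : ∀ x y, K₁ (ι x) (ι y) = K₁ x y) (hAι : ∀ x y, A (ι x) (ι y) = -A x y)
    (hnear : ∀ x y, |K₂ x y - K₁ x y * (1 + A x y)| ≤ η * K₁ x y)
    {f : X → ℝ} (hfι : ∀ x, f (ι x) = f x) (hf : Integrable (fun x => f x ^ 2) μ)
    (hI2 : Integrable (fun p : X × X => f p.1 * K₂ p.1 p.2 * f p.2) (μ.prod μ))
    (hIA : Integrable (fun p : X × X => f p.1 * (K₁ p.1 p.2 * A p.1 p.2) * f p.2) (μ.prod μ))
    (hI : Integrable (fun p : X × X => |f p.1| * K₁ p.1 p.2 * |f p.2|) (μ.prod μ))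
    (hIs : Integrable (fun p : X × X => f p.1 * K₁ p.1 p.2 * f p.2) (μ.prod μ))
    (hI₁ : Integrable (fun p : X × X => K₁ p.1 p.2 * f p.1 ^ 2) (μ.prod μ))
    (hI₂ : Integrable (fun p : X × X => K₁ p.1 p.2 * f p.2 ^ 2) (μ.prod μ)) :
    ∫ x, ∫ y, f x * K₂ x y * f y ∂μ ∂μ ≤ (∫ x, ∫ y, f x * K₁ x y * f y ∂μ ∂μ) + η * M₁ * ∫ x, f x ^ 2 ∂μ := by
  have h := abs_le.mp (abs_form_sub_le_of_kernel_near_odd ι hι hη hK₁ hsymm hrow hK₁ι hAι hnear hfι hf hI2 hIA hI hIs hI₁ hI₂)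
  linarith [h.2]

end Summit.QuantumFields.YangMills.Theorems.FemtoTransferGap.KernelParity

end
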